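import Mathlib
import Literature.LinearAlgebra.Matrix.PermanentSubperm
import Literature.Computability.AlgebraicComplexity.OrbitClosureProofs
import Literature.Computability.Complexity.OccurrenceObstructionsBIP
import Summits.ValiantsHypothesis.ValiantsHypothesis.Theorems.ValuativeGCTValuativeFlipCyclicPencilAdjugate
import Summits.ValiantsHypothesis.ValiantsHypothesis.Theorems.ValuativeGCTValuativeFlipLinearEntryDeterminants

/-!
# Linear-entry permanents: blocks, and the small-body test forms of `Δ_m(X₀₀^{m-n} per_n)`

Crux `ValuativeGCT.ValuativeFlip` (stmt-ValiantsHypothesis-12624), wall-breaker axis D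
("det-orbit-closure multiplicity bounds for `detCensus`", seat k3 gen 1/2).  Per-side companion of
`ValuativeGCTValuativeFlipLinearEntryDeterminants`: it supplies the hypothesis of the general
no-small-body vanishing theorem `nsb_eq_zero_of_forall_body_le_of_testForms`
(`…NoSmallBodyCoreGeneral`) for the PADDED PERMANENT with body budget `B = n`.

For block sizes `a_j ≥ 1` with `Σ a_j ≤ n`, monomials `x^{γ_j}` of degree `a_j` and scalars `t_j`,

  `G_t = X_top^{m - Σ a_j} · ∏_j (X_top^{a_j} + t_j · x^{γ_j}) = X_top^{m-n} · per_n(N)`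

for an `n × n` matrix `N` of LINEAR forms (block diagonal: a scalar block `X_top · 1` and, for each
`j`, the cyclic pencil `X_top · 1 + cshift⟦w⟧`, whose PERMANENT is `X_top^{a_j} + ∏ wᵢ` — the same two
permutations survive as for the determinant, `perm_eq_one_or_eq_finRotate_symm`, but without signs),
and `X_top^{m-n} · per_n(N)` is a linear substitution of `X₀₀^{m-n} per_n` (padding variable `↦ X_top`,
block variable `X_(i,j) ↦ N i j`), hence a point of `End · (X₀₀^{m-n} per_n) ⊆ Δ_m(X₀₀^{m-n} per_n)`.

Contents: ring homomorphisms and reindexing on permanents (`nsb_map_permanent`,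
`nsb_permanent_reindex`); block calculus for linear-entry permanents (`nsb_linPer_mul/one/prod/X_pow`,
the cyclic block `nsb_permanent_smul_one_add_cyclicShift`, `nsb_linPer_X_pow_add_smul_monomial`,
`nsb_linPer_testForm`); the substitution `nsb_linSubst_paddedPerFormLex_eq`; and the test forms
`nsb_testForm_mem_orbitClosure_paddedPerFormLex`.  Elementary and definition-free [folklore].
-/

-- `Summit.ValiantsHypothesis.ValiantsHypothesis.…` is the tree's mandated single-conjunct layout (Sub = Summit).
set_option linter.dupNamespace false

namespace Summit.ValiantsHypothesis.ValiantsHypothesis.Theorems.ValuativeFlip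

open MvPolynomial
open Literature.NumberTheory.DiophantineGeometry Literature.Computability.AlgebraicComplexity
open Literature.Computability.Complexity
open scoped BigOperators Matrix

noncomputable section

/-! ## Permanents under ring homomorphisms and reindexing -/

section PermanentTools

variable {ι : Type*} [Fintype ι] [DecidableEq ι]

/-- Ring homomorphisms commute with permanents. [folklore] -/
theorem nsb_map_permanent {R S F : Type*} [CommSemiring R] [CommSemiring S] [FunLike F R S]
    [RingHomClass F R S] (f : F) (M : Matrix ι ι R) :
    f M.permanent = (M.map f).permanent := by
  unfold Matrix.permanent
  rw [map_sum]
  refine Finset.sum_congr rfl fun σ _ => ?_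
  rw [map_prod]
  rfl

/-- Reindexing along an equivalence does not change the permanent. [folklore] -/
theorem nsb_permanent_reindex {ι' : Type*} [Fintype ι'] [DecidableEq ι'] {R : Type*} [CommSemiring R]
    (e : ι ≃ ι') (M : Matrix ι ι R) : (Matrix.reindex e e M).permanent = M.permanent := by
  unfold Matrix.permanent
  rw [← Equiv.sum_comp (Equiv.permCongr e)]
  refine Fintype.sum_congr _ _ fun σ => ?_
  rw [← Equiv.prod_comp e]
  refine Fintype.prod_congr _ _ fun i => ?_
  simp only [Matrix.reindex_apply, Matrix.submatrix_apply, Equiv.permCongr_apply,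
    Equiv.symm_apply_apply]

end PermanentTools

/-! ## The cyclic block -/

section CyclicPermanent

variable {R : Type*} [CommRing R] {n : ℕ}

open Fin.CommRing in  -- `Fin (n+1)` as a commutative ring (scoped Mathlib instance): cyclic index arithmetic
/-- **Permanent of the cyclic pencil**: `per (z·1 + X_w) = z^{n+1} + ∏ wⱼ` (only the identity and
the rotation `i ↦ i − 1` contribute, `perm_eq_one_or_eq_finRotate_symm`; the permanent twin of
`det_smul_one_sub_cyclicShift`). [folklore] -/
theorem nsb_permanent_smul_one_add_cyclicShift (z : R) (w : Fin (n + 1) → R) :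
    (z • (1 : Matrix (Fin (n + 1)) (Fin (n + 1)) R) +
      Matrix.of (fun i j : Fin (n + 1) => if j = i + 1 then w i else 0)).permanent = z ^ (n + 1) + ∏ j, w j := by
  have happly : ∀ l c : Fin (n + 1), (z • (1 : Matrix (Fin (n + 1)) (Fin (n + 1)) R) +
      Matrix.of (fun i j : Fin (n + 1) => if j = i + 1 then w i else 0)) l c =
      (if l = c then z else 0) + (if c = l + 1 then w l else 0) := fun l c => by
    simp [Matrix.one_apply]
  rcases Nat.eq_zero_or_pos n with rfl | hn
  · rw [Matrix.permanent_eq_elem_of_card_eq_one (by simp) 0, happly]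
    have h01 : (0 : Fin (0 + 1)) = 0 + 1 := by decide
    rw [if_pos rfl, if_pos h01, Fin.prod_univ_succ, Fin.prod_univ_zero, mul_one, pow_one]
  set N : Matrix (Fin (n + 1)) (Fin (n + 1)) R := z • (1 : Matrix (Fin (n + 1)) (Fin (n + 1)) R) +
      Matrix.of (fun i j : Fin (n + 1) => if j = i + 1 then w i else 0) with hN
  have h10 : (1 : Fin (n + 1)) ≠ 0 := by
    rw [Ne, Fin.one_eq_zero_iff]
    omega
  have hρ : ∀ i, (finRotate (n + 1)).symm i = i - 1 := fun i => by
    rw [Equiv.symm_apply_eq, finRotate_apply]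
    ring
  have hne : (1 : Equiv.Perm (Fin (n + 1))) ≠ (finRotate (n + 1)).symm := by
    intro heq
    have := congrArg (fun π : Equiv.Perm (Fin (n + 1)) => π 0) heq
    simp only [Equiv.Perm.one_apply, hρ, zero_sub] at this
    exact h10 (neg_eq_zero.mp this.symm)
  have hzero : ∀ π : Equiv.Perm (Fin (n + 1)), π ≠ 1 ∧ π ≠ (finRotate (n + 1)).symm →
      ∏ i, N (π i) i = 0 := by
    rintro π ⟨hπ1, hπρ⟩
    have hex : ∃ i, ¬ (π i = i ∨ π i = i - 1) := by
      by_contra hno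
      push Not at hno
      rcases perm_eq_one_or_eq_finRotate_symm hn π hno with h | h
      · exact hπ1 h
      · exact hπρ h
    obtain ⟨i, hi⟩ := hex
    push Not at hi
    have hNi : N (π i) i = 0 := by
      rw [happly, if_neg hi.1, if_neg, add_zero]
      intro h
      exact hi.2 (eq_sub_iff_add_eq.mpr h.symm)
    exact Finset.prod_eq_zero (f := fun j => N (π j) j) (Finset.mem_univ i) hNi
  unfold Matrix.permanent
  rw [Fintype.sum_eq_add (1 : Equiv.Perm (Fin (n + 1))) (finRotate (n + 1)).symm hne hzero]
  -- the identity term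
  have h1 : ∏ i, N ((1 : Equiv.Perm (Fin (n + 1))) i) i = z ^ (n + 1) := by
    have h : ∀ i : Fin (n + 1), ¬ (i = i + 1) := fun i h => h10 (left_eq_add.mp h)
    have h' : ∀ i : Fin (n + 1), N ((1 : Equiv.Perm (Fin (n + 1))) i) i = z := fun i => by
      rw [Equiv.Perm.one_apply, happly, if_pos rfl, if_neg (h i), add_zero]
    rw [Finset.prod_congr rfl (fun i _ => h' i), Finset.prod_const, Finset.card_univ, Fintype.card_fin]
  -- the rotation term
  have h2 : ∏ i, N ((finRotate (n + 1)).symm i) i = ∏ j, w j := by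
    have h : ∀ i : Fin (n + 1), ¬ (i - 1 = i) := fun i h => h10 (sub_eq_self.mp h)
    have h' : ∀ i : Fin (n + 1), N ((finRotate (n + 1)).symm i) i = w (i - 1) := fun i => by
      rw [hρ, happly, if_neg (h i), sub_add_cancel, if_pos rfl, zero_add]
    rw [Finset.prod_congr rfl (fun i _ => h' i)]
    exact Fintype.prod_equiv (Equiv.subRight (1 : Fin (n + 1))) (fun i => w (i - 1)) w fun _ => rfl
  rw [h1, h2]

end CyclicPermanent

/-! ## Block calculus for linear-entry permanents

"`f` is an `n × n` linear-entry permanent" is written out as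
`∃ N : Matrix (Fin n) (Fin n) (MvPolynomial σ ℂ), (∀ a b, (N a b).IsHomogeneous 1) ∧ N.permanent = f`. -/

section Blocks

variable {σ : Type*}

/-- Products: block-diagonal assembly (`fromBlocks`, `Matrix.permanent_fromBlocks_zero₂₁`). [folklore] -/
theorem nsb_linPer_mul {n₁ n₂ : ℕ} {f g : MvPolynomial σ ℂ}
    (hf : ∃ N : Matrix (Fin n₁) (Fin n₁) (MvPolynomial σ ℂ), (∀ a b, (N a b).IsHomogeneous 1) ∧ N.permanent = f)
    (hg : ∃ N : Matrix (Fin n₂) (Fin n₂) (MvPolynomial σ ℂ), (∀ a b, (N a b).IsHomogeneous 1) ∧ N.permanent = g) :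
    ∃ N : Matrix (Fin (n₁ + n₂)) (Fin (n₁ + n₂)) (MvPolynomial σ ℂ),
      (∀ a b, (N a b).IsHomogeneous 1) ∧ N.permanent = f * g := by
  classical
  obtain ⟨N₁, hN₁, rfl⟩ := hf
  obtain ⟨N₂, hN₂, rfl⟩ := hg
  refine ⟨Matrix.reindex finSumFinEquiv finSumFinEquiv (Matrix.fromBlocks N₁ 0 0 N₂), ?_, ?_⟩
  · intro a b
    rw [Matrix.reindex_apply, Matrix.submatrix_apply]
    rcases finSumFinEquiv.symm a with a₁ | a₂ <;> rcases finSumFinEquiv.symm b with b₁ | b₂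
    · rw [Matrix.fromBlocks_apply₁₁]; exact hN₁ _ _
    · rw [Matrix.fromBlocks_apply₁₂]; exact isHomogeneous_zero _ _ 1
    · rw [Matrix.fromBlocks_apply₂₁]; exact isHomogeneous_zero _ _ 1
    · rw [Matrix.fromBlocks_apply₂₂]; exact hN₂ _ _
  · rw [nsb_permanent_reindex, Matrix.permanent_fromBlocks_zero₂₁]

/-- The empty permanent: `1` is a `0 × 0` linear-entry permanent. [folklore] -/
theorem nsb_linPer_one :
    ∃ N : Matrix (Fin 0) (Fin 0) (MvPolynomial σ ℂ), (∀ a b, (N a b).IsHomogeneous 1) ∧ N.permanent = 1 :=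
  ⟨0, fun a => Fin.elim0 a, by rw [Matrix.permanent_isEmpty]⟩

/-- Finite products of linear-entry permanents are linear-entry permanents (sizes add). [folklore] -/
theorem nsb_linPer_prod {ι : Type*} (s : Finset ι) (n : ι → ℕ) (f : ι → MvPolynomial σ ℂ)
    (h : ∀ i ∈ s, ∃ N : Matrix (Fin (n i)) (Fin (n i)) (MvPolynomial σ ℂ),
      (∀ a b, (N a b).IsHomogeneous 1) ∧ N.permanent = f i) :
    ∃ N : Matrix (Fin (∑ i ∈ s, n i)) (Fin (∑ i ∈ s, n i)) (MvPolynomial σ ℂ),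
      (∀ a b, (N a b).IsHomogeneous 1) ∧ N.permanent = ∏ i ∈ s, f i := by
  classical
  induction s using Finset.induction_on with
  | empty =>
    rw [Finset.sum_empty, Finset.prod_empty]
    exact nsb_linPer_one
  | @insert i s hi ih =>
    rw [Finset.sum_insert hi, Finset.prod_insert hi]
    exact nsb_linPer_mul (h i (Finset.mem_insert_self i s))
      (ih fun i' hi' => h i' (Finset.mem_insert_of_mem hi'))

/-- Powers of a variable: `X_u ^ n = per (X_u · 1)`. [folklore] -/
theorem nsb_linPer_X_pow (u : σ) (n : ℕ) :
    ∃ N : Matrix (Fin n) (Fin n) (MvPolynomial σ ℂ), (∀ a b, (N a b).IsHomogeneous 1) ∧ N.permanent = X u ^ n := by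
  classical
  refine ⟨(X u : MvPolynomial σ ℂ) • (1 : Matrix (Fin n) (Fin n) (MvPolynomial σ ℂ)), ?_, ?_⟩
  · intro a b
    rw [Matrix.smul_apply, Matrix.one_apply, smul_eq_mul, mul_ite, mul_one, mul_zero]
    split_ifs
    · exact isHomogeneous_X ℂ u
    · exact isHomogeneous_zero _ _ 1
  · rw [Matrix.permanent_smul, Matrix.permanent_one, mul_one, Fintype.card_fin]

open Fin.CommRing in  -- `Fin (n+1)` as a commutative ring (scoped Mathlib instance): cyclic index arithmetic
/-- **The cyclic monomial block (permanent).**  For a monomial `x^γ` of degree `n + 1 ≥ 1`, a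
variable `u` and a scalar `t`, `X_u^{n+1} + t · x^γ` is an `(n+1) × (n+1)` linear-entry PERMANENT
(cyclic pencil `X_u · 1 + cshift⟦w⟧`, the weights listing the variables of `x^γ`, the last one
multiplied by `t`). [folklore] -/
theorem nsb_linPer_X_pow_add_smul_monomial [DecidableEq σ] (u : σ) (t : ℂ) {n : ℕ}
    (γ : σ →₀ ℕ) (hγ : γ.degree = n + 1) :
    ∃ N : Matrix (Fin (n + 1)) (Fin (n + 1)) (MvPolynomial σ ℂ),
      (∀ a b, (N a b).IsHomogeneous 1) ∧ N.permanent = X u ^ (n + 1) + t • monomial γ 1 := by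
  classical
  -- enumerate the variables of `x^γ` with multiplicity
  set L : List σ := γ.toMultiset.toList with hL
  have hlen : L.length = n + 1 := by
    rw [hL, Multiset.length_toList, Finsupp.card_toMultiset, ← hγ, Finsupp.degree]
    rfl
  set y : Fin (n + 1) → σ := fun i => L.get (Fin.cast hlen.symm i) with hy
  have hprod : ∏ i : Fin (n + 1), (X (y i) : MvPolynomial σ ℂ) = monomial γ 1 := by
    have h1 : ∏ i : Fin (n + 1), (X (y i) : MvPolynomial σ ℂ) = (L.map (X : σ → MvPolynomial σ ℂ)).prod := by
      rw [← List.prod_ofFn]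
      congr 1
      apply List.ext_getElem
      · rw [List.length_ofFn, List.length_map, hlen]
      · intro i h₁ h₂
        simp only [List.getElem_ofFn, List.getElem_map, hy, List.get_eq_getElem, Fin.val_cast]
    rw [h1, hL, ← Multiset.prod_coe, ← Multiset.map_coe, Multiset.coe_toList, Finsupp.toMultiset_map,
      Finsupp.prod_toMultiset, Finsupp.prod_mapDomain_index_inj (X_injective (σ := σ) (R := ℂ))]
    exact prod_X_pow_eq_monomial
  -- the weights
  set w : Fin (n + 1) → MvPolynomial σ ℂ :=
    fun i => if i = Fin.last n then t • X (y i) else X (y i) with hw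
  have hwprod : ∏ i, w i = t • monomial γ 1 := by
    have hlast : w (Fin.last n) = t • X (y (Fin.last n)) := by rw [hw]; exact if_pos rfl
    have hcs : ∀ i : Fin n, w (Fin.castSucc i) = X (y (Fin.castSucc i)) := fun i => by
      rw [hw]; exact if_neg (Fin.castSucc_ne_last i)
    rw [← hprod, Fin.prod_univ_castSucc, Fin.prod_univ_castSucc, hlast,
      Finset.prod_congr rfl (fun i _ => hcs i), mul_smul_comm]
  refine ⟨(X u : MvPolynomial σ ℂ) • (1 : Matrix (Fin (n + 1)) (Fin (n + 1)) (MvPolynomial σ ℂ)) +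
      Matrix.of (fun i j : Fin (n + 1) => if j = i + 1 then w i else 0), ?_, ?_⟩
  · intro a b
    rw [Matrix.add_apply, Matrix.smul_apply, Matrix.one_apply, Matrix.of_apply]
    refine IsHomogeneous.add ?_ ?_
    · rw [smul_eq_mul, mul_ite, mul_one, mul_zero]
      split_ifs
      · exact isHomogeneous_X ℂ u
      · exact isHomogeneous_zero _ _ 1
    · split_ifs
      · rw [hw]
        dsimp only
        split_ifs
        · rw [smul_eq_C_mul]; exact isHomogeneous_C_mul_X _ _
        · exact isHomogeneous_X ℂ _
      · exact isHomogeneous_zero _ _ 1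
  · rw [nsb_permanent_smul_one_add_cyclicShift, hwprod]

/-- **The small-body test forms are linear-entry permanents.**  For a variable `u`, blocks
`j ∈ J` with sizes `a j ≥ 1`, monomials `x^{γ j}` of degree `a j`, scalars `t j`, and any `n`:
`X_u^{n - Σ a} · ∏_{j ∈ J} (X_u^{a j} + t j · x^{γ j})` is an `((n - Σa) + Σa) × ((n - Σa) + Σa)`
linear-entry permanent. [folklore] -/
theorem nsb_linPer_testForm [DecidableEq σ] {ι : Type*} (J : Finset ι) (u : σ) (a : ι → ℕ)
    (γ : ι → σ →₀ ℕ) (t : ι → ℂ) (ha : ∀ j ∈ J, 1 ≤ a j) (hγ : ∀ j ∈ J, (γ j).degree = a j) (n : ℕ) :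
    ∃ N : Matrix (Fin ((n - ∑ j ∈ J, a j) + ∑ j ∈ J, a j)) (Fin ((n - ∑ j ∈ J, a j) + ∑ j ∈ J, a j)) (MvPolynomial σ ℂ),
      (∀ a b, (N a b).IsHomogeneous 1) ∧
      N.permanent = X u ^ (n - ∑ j ∈ J, a j) * ∏ j ∈ J, (X u ^ (a j) + t j • monomial (γ j) 1) := by
  refine nsb_linPer_mul (nsb_linPer_X_pow u _) (nsb_linPer_prod J a _ fun j hj => ?_)
  obtain ⟨n', hn'⟩ : ∃ n', a j = n' + 1 := ⟨a j - 1, (Nat.sub_add_cancel (ha j hj)).symm⟩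
  rw [hn']
  exact nsb_linPer_X_pow_add_smul_monomial u (t j) (γ j) (by rw [hγ j hj, hn'])

end Blocks

/-! ## The padded permanent at a linear-entry matrix, and the test forms in its orbit closure -/

section PaddedPer

/-- **`X_top^{m-n} · per_n(N)` is a point of `End · (X₀₀^{m-n} per_n)`.**  For `n ≤ m` and an
`n × n` matrix `N` of linear forms (indexed by the corner block `BlockIdx n m`), the substitution
sending the padding variable `X₀₀` to `X_top` and the block variable `X_(i,j)` to `N i j` (all other
variables to `0`) maps `X₀₀^{m-n} per_n` to `X_top^{m-n} · per N`. [folklore] -/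
theorem nsb_linSubst_paddedPerFormLex_eq {n m : ℕ} [NeZero m] (hnm : n ≤ m)
    (N : Matrix (BlockIdx n m) (BlockIdx n m) (MvPolynomial (MatIdx m) ℂ))
    (hN : ∀ a b, (N a b).IsHomogeneous 1) :
    ∃ A : Matrix (MatIdx m) (MatIdx m) ℂ,
      linSubst (MatIdx m) ℂ A (paddedPerFormLex ℂ n m) = X (topMatIdx m) ^ (m - n) * N.permanent := by
  classical
  -- the substitution matrix: block columns carry the coefficients of `N`, the padding column `X_top`
  refine ⟨fun l p => if h : m - n ≤ ((ofLex p).1 : ℕ) ∧ m - n ≤ ((ofLex p).2 : ℕ) then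
      coeff (Finsupp.single l 1) (N ⟨(ofLex p).1, h.1⟩ ⟨(ofLex p).2, h.2⟩)
    else (if l = topMatIdx m then 1 else 0), ?_⟩
  rw [paddedPerFormLex_eq, map_mul, map_pow]
  congr 1
  · -- the padding variable
    rcases Nat.eq_or_lt_of_le hnm with heq | hlt
    · have hpad : ∀ x y : MvPolynomial (MatIdx m) ℂ, m - n = 0 → x ^ (m - n) = y ^ (m - n) :=
        fun x y h0 => by rw [h0, pow_zero, pow_zero]
      exact hpad _ _ (by omega)
    · congr 1
      rw [linSubst_X]
      have hmn : ¬ (m - n = 0) := by omega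
      simp only [ofLex_toLex, Fin.val_zero, nonpos_iff_eq_zero, hmn, false_and, dite_false, ite_smul,
        one_smul, zero_smul, Finset.sum_ite_eq', Finset.mem_univ, if_true]
  · -- the block
    rw [perPoly, nsb_map_permanent, nsb_map_permanent]
    congr 1
    refine Matrix.ext fun i j => ?_
    rw [Matrix.map_apply, Matrix.map_apply, Matrix.mvPolynomialX_apply, rename_X, linSubst_X,
      nsb_eq_sum_coeff_smul_X_of_isHomogeneous_one (hN i j)]
    refine Finset.sum_congr rfl fun l _ => ?_
    simp only [ofLex_toLex]
    rw [dif_pos ⟨i.2, j.2⟩]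

/-- **Small-body test forms are points of `Δ_m(X₀₀^{m-n} per_n)` up to body `n`.**  For `n ≤ m`,
a variable `u = x_top`, blocks `j ∈ J` with sizes `a j ≥ 1` summing to at most `n`, monomials
`x^{γ j}` of degree `a j` and scalars `t j`:
`X_top^{m - Σ a} · ∏_{j ∈ J} (X_top^{a j} + t j · x^{γ j}) ∈ Δ_m(X₀₀^{m-n} per_n)` — it is
`X_top^{m-n} · per_n(N)` for an `n × n` linear-entry matrix `N` (`nsb_linPer_testForm`,
`nsb_linSubst_paddedPerFormLex_eq`, `endOrbit_subset_orbitClosure_holds`). [folklore] -/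
theorem nsb_testForm_mem_orbitClosure_paddedPerFormLex {n m : ℕ} [NeZero m] (hnm : n ≤ m) {ι : Type*}
    (J : Finset ι) (a : ι → ℕ) (γ : ι → MatIdx m →₀ ℕ) (t : ι → ℂ) (ha : ∀ j ∈ J, 1 ≤ a j)
    (hγ : ∀ j ∈ J, (γ j).degree = a j) (hn : ∑ j ∈ J, a j ≤ n) :
    X (topMatIdx m) ^ (m - ∑ j ∈ J, a j) * ∏ j ∈ J, (X (topMatIdx m) ^ (a j) + t j • monomial (γ j) 1) ∈
      orbitClosure (paddedPerFormLex ℂ n m) := by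
  classical
  obtain ⟨N, hN, hper⟩ := nsb_linPer_testForm J (topMatIdx m) a γ t ha hγ n
  -- reindex `N` by the corner block
  have hcard : Fintype.card (BlockIdx n m) = (n - ∑ j ∈ J, a j) + ∑ j ∈ J, a j := by
    rw [card_blockIdx hnm, Nat.sub_add_cancel hn]
  set e : Fin ((n - ∑ j ∈ J, a j) + ∑ j ∈ J, a j) ≃ BlockIdx n m := (Fintype.equivFinOfCardEq hcard).symm with he
  set N' : Matrix (BlockIdx n m) (BlockIdx n m) (MvPolynomial (MatIdx m) ℂ) := Matrix.reindex e e N with hN'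
  have hN'h : ∀ a b, (N' a b).IsHomogeneous 1 := fun a b => by
    rw [hN', Matrix.reindex_apply, Matrix.submatrix_apply]; exact hN _ _
  have hper' : N'.permanent = X (topMatIdx m) ^ (n - ∑ j ∈ J, a j) *
      ∏ j ∈ J, (X (topMatIdx m) ^ (a j) + t j • monomial (γ j) 1) := by
    rw [hN', nsb_permanent_reindex, hper]
  obtain ⟨A, hA⟩ := nsb_linSubst_paddedPerFormLex_eq hnm N' hN'h
  have key : linSubst (MatIdx m) ℂ A (paddedPerFormLex ℂ n m) =
      X (topMatIdx m) ^ (m - ∑ j ∈ J, a j) * ∏ j ∈ J, (X (topMatIdx m) ^ (a j) + t j • monomial (γ j) 1) := by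
    rw [hA, hper', ← mul_assoc, ← pow_add]
    congr 2
    omega
  rw [← key]
  exact endOrbit_subset_orbitClosure_holds _ ⟨A, rfl⟩

end PaddedPer

end

end Summit.ValiantsHypothesis.ValiantsHypothesis.Theorems.ValuativeFlip
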